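/-
Copyright (c) 2026 the pub-hodgecm-mathlib formalisation cell (harness21).  Prover seat hodgecm-mathlib-LH4-p04 (g2), req620 Track A «(D-RAM) FOUR-FRAME» squad
(MS ROAD A, STAGE B brick B3₂ «TYPE-2 STRATA TABLE» — exclusion of the residual family X1 of the sieve (★ part 6a∕6b, census `CENSUS-B3type2.v1` §1)).  2026-09-04.
-/
import Summits.HodgeConjecture.HodgeConjecture.Theorems.F0P3cDyRamDiagonalHNFDualFrameValuesTypeTwo   -- ★ part 5 (this seat): `dualFrame_sandwich`, `gram_values_of_type`, `v_inv_map_pow`, `v_dualFrameOne_*`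
import Literature.NumberTheory.Automorphic.UnitaryLatticeTreeTypes                               -- ★ `scaleLattice_dualLatt_le_of_isVertexLattice`
import HarnessLib

/-!
# Crux `H413`, line LH4 «(D-RAM) FOUR-FRAME» road — unit U3_Laws (iii), MS ROAD A, STAGE B brick B3₂: THE RESIDUAL FAMILY X1 IS NOT TYPE-2 POLARISABLE
# (`b ≥ 2` even, `c ∈ {1, 2}`, `|z| ≤ |ϖ|^c`, `|xz − yϖ^b| ≤ |ϖ|^c`: the sieve survivor outside MEMO v2.1's (E1)–(E4))

Cell `hodgecm-mathlib` (D-0151), FLOOR 0, crux item H413 = `stmt-HodgeConjecture-24833`, route of record `HCCMUnconditional`; squad F0∕P3c∕LH4 (req618∕req620); registered stub served: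
`F0P3cDyRamFourFrameU3.stub_U3_stableModelSum` (MS).  THEOREMS ONLY (no `def`, no instance, no notation, no `sorry`, default heartbeats); lane
`--supports stmt-HodgeConjecture-24833 --as helper` (count-neutral).  STAGE B type-2 twin: ★ part 6b `typeTwo_sieve` leaves, besides the genuine type-2 strata, eleven residual
families X1–X11, each to be killed on the Gram ∕ dual-Gram ENTRIES; this file kills X1 (the 11th disjunct of ★ `typeTwo_sieve`), taking the normalisation `hn` as a binder (so that
`|x| = 1` is available — LH4-r01 (g2) BOX CS remark).

THE MATHEMATICS (census §1, sample).  On X1 the sandwich (★ part 5) and the parity of `|D_i|` force `|D₀| = |D₁| = exp b`, `|D₂| = exp 2(c−1)`.  The dual-Gram condition (II)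
`ϖN^♯ ⊆ N` is read on the COLUMNS of the dual frame `U_D` (★ p855301) through ★ `mem_latt_hnf_iff`: column 1's second test is `|D₀ + N(x)D₁| ≤ |ϖ|·|D₀D₁|·|ϖ|^{−2b} = exp 1`
(§2 `v_gramCore_le`), and column 2's third test is `|S| ≤ |ϖ|^{2c−1}` with `S = 1∕D₂ + N(z)∕(N(ϖ^b)D₁) + N(u)∕D₀`, `ϖ^b u = xz − yϖ^b` (§2 `v_dualGram22_le`).  For `c = 2`:
`|D₂N(y)| = exp 2 > exp 1 ≥ |D₀ + N(x)D₁|`, so `G₀₀ = D₀ + N(x)D₁ + N(y)D₂` has `|G₀₀| = exp 2 > 1` — contradicting (I).  For `c = 1`: (I₀₀) with `|N(y)D₂| = 1` gives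
`E := D₀ + N(x)D₁ ∈ 𝒪`, and `S − 1∕D₂ = [N(z)E + D₁(N(yϖ^b) − xzσyσϖ^b − yϖ^bσxσz)]∕(N(ϖ^b)D₀D₁)` has `|·| ≤ max(|z|², |ϖ|^b, |z|) ≤ |ϖ| < 1 = |1∕D₂|`, so `|S| = 1 > |ϖ|` —
contradicting (II).  Hence no `σ`-fixed diagonal form makes an X1 lattice a type-2 vertex (oracle: weight `0`, e.g. `b = 4, c = 1, v z = 2` in key (7,5,5)).

WHAT IS PROVED.  §1 `smul_dualFrame_col_mem` (any type: `ϖ·U_D e_j ∈ N`).  §2 `v_gramCore_le` (column 1, test 2), `v_dualGram22_le` (column 2, test 3) — the two dual-Gram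
inequalities in closed form.  §3 HEAD `not_typeTwoPolarisable_X1`.
HONEST LABEL.  Count-neutral (`--supports`); nothing printed is asserted; (MS) stays a PROVER TARGET (empirical census law — MEMO v2∕v2.1 is its paper proof); `HC_CM` is proved only
modulo the 7 printed citations (2 remaining named inputs: hLiu418 = `stmt-HodgeConjecture-24832`, h413 = `stmt-HodgeConjecture-24833`) until rung 0 closes.

## References
* [Jacobowitz1962] R. Jacobowitz, *Hermitian forms over local fields*, Amer. J. Math. 84 (1962), §4 (dual bases), §7–§8 (`𝔭`-modular lattices).
* [Kottwitz1986BaseChangeUnits] R. E. Kottwitz, *Base change for unit elements of Hecke algebras*, Compositio Math. 60 (1986), §1 pp. 240–241 (fixed lattices counted by position).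
* [Serre1980Trees] J.-P. Serre, *Trees*, Springer (1980), Ch. II §1.1 (Hermite normal forms).
-/

set_option autoImplicit false

noncomputable section

namespace Summit.HodgeConjecture.HodgeConjecture.Cruxes.H413.F0P3cDyRamDiagonalTypeTwoExclX1

open Matrix
open Literature.NumberTheory.Automorphic Literature.NumberTheory.Automorphic.HermitianLattice
open Literature.NumberTheory.Automorphic.UnitaryLatticeTree
open Summit.HodgeConjecture.HodgeConjecture.Cruxes.H413.F0P3cDyRamDiagonalTorusDefs
open Summit.HodgeConjecture.HodgeConjecture.Cruxes.H413.F0P3cDyRamDiagonalHNFDual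
open Summit.HodgeConjecture.HodgeConjecture.Cruxes.H413.F0P3cDyRamDiagonalStableLatticeHNF
open Summit.HodgeConjecture.HodgeConjecture.Cruxes.H413.F0P3cDyRamDiagonalHNFDualFrameValuesTypeTwo
open scoped Valued WithZero Matrix MatrixGroups

variable {K : Type*} [Field K] [Valued K ℤᵐ⁰]

/-! ## §1  `ϖ` times every column of the dual frame lies in the lattice -/

/-- **`ϖ·U_D·e_j ∈ N`** for a vertex lattice `N = latt V` (HNF) of any type for `diag(D)` — `ϖN^♯ ⊆ N` (★ `scaleLattice_dualLatt_le_of_isVertexLattice`) read on the columns of the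
dual frame `U_D` of ★ p855301 (`N^♯ = latt U_D`). [cite: Jacobowitz1962, §4, §7–§8] -/
theorem smul_dualFrame_col_mem {σ : K →+* K} (hvσ : ∀ a, Valued.v (σ a) = Valued.v a) {ϖ : K} (hϖ0 : ϖ ≠ 0)
    {D : Fin 3 → K} (hD0 : ∀ i, D i ≠ 0) (b c : ℕ) (x y z : K) {d : ℕ}
    (hM : IsVertexLattice σ ϖ (Matrix.diagonal D) d (latt (Matrix.of ![![1, 0, 0], ![x, ϖ ^ b, 0], ![y, z, ϖ ^ c]]))) (j : Fin 3) :
    ϖ • (!![(D 0)⁻¹, -σ x * (σ ϖ ^ b)⁻¹ * (D 0)⁻¹, (σ x * σ z * (σ ϖ ^ b)⁻¹ - σ y) * (σ ϖ ^ c)⁻¹ * (D 0)⁻¹;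
        0, (σ ϖ ^ b)⁻¹ * (D 1)⁻¹, -σ z * (σ ϖ ^ b)⁻¹ * (σ ϖ ^ c)⁻¹ * (D 1)⁻¹;
        0, 0, (σ ϖ ^ c)⁻¹ * (D 2)⁻¹] : Matrix (Fin 3) (Fin 3) K).mulVec (Pi.single j 1) ∈
      latt (Matrix.of ![![1, 0, 0], ![x, ϖ ^ b, 0], ![y, z, ϖ ^ c]] : Matrix (Fin 3) (Fin 3) K) := by
  have hH : IsUnit (Matrix.diagonal D).det := by
    rw [Matrix.det_diagonal]; exact (Finset.prod_ne_zero_iff.2 fun i _ => hD0 i).isUnit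
  have hsup := scaleLattice_dualLatt_le_of_isVertexLattice hvσ hH hM
  rw [dualLatt_diagonal_latt_hnf σ hvσ hϖ0 hD0 x y z b c] at hsup
  exact hsup (Submodule.mem_map.2 ⟨_, mulVec_single_mem_latt _ j, rfl⟩)

/-! ## §2  Two dual-Gram inequalities in closed form -/

/-- **COLUMN 1, TEST 2: `|D₀ + N(x)·D₁| · exp(2b) ≤ |D₀|·|D₁|·exp 1`** — i.e. with `|D₀| = |D₁| = exp b`: `|D₀ + N(x)D₁| ≤ exp 1` (the dual-Gram entry `ϖ·G″₁₁` is integral).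
[cite: Jacobowitz1962, §4, §7–§8] -/
theorem v_gramCore_le {σ : K →+* K} (hvσ : ∀ a, Valued.v (σ a) = Valued.v a) {ϖ : K} (hϖ : Valued.v ϖ = WithZero.exp (-1 : ℤ))
    {D : Fin 3 → K} (hD0 : ∀ i, D i ≠ 0) (b c : ℕ) (x y z : K) {d : ℕ}
    (hM : IsVertexLattice σ ϖ (Matrix.diagonal D) d (latt (Matrix.of ![![1, 0, 0], ![x, ϖ ^ b, 0], ![y, z, ϖ ^ c]]))) :
    Valued.v (D 0 + x * σ x * D 1) * ((Valued.v (D 0))⁻¹ * (Valued.v (D 1))⁻¹) ≤ WithZero.exp (1 - 2 * (b : ℤ)) := by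
  have hϖ0 : ϖ ≠ 0 := (Valuation.ne_zero_iff Valued.v).1 (by rw [hϖ]; exact WithZero.exp_ne_zero)
  have hσϖ0 : σ ϖ ^ b ≠ 0 := pow_ne_zero _ ((map_ne_zero σ).2 hϖ0)
  have hmem := smul_dualFrame_col_mem hvσ hϖ0 hD0 b c x y z hM 1
  rw [mem_latt_hnf_iff x y z (pow_ne_zero b hϖ0) (pow_ne_zero c hϖ0)] at hmem
  obtain ⟨-, h2, -⟩ := hmem
  simp only [Pi.smul_apply, smul_eq_mul, Matrix.mulVec_single_one, Matrix.col_apply] at h2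
  -- the tested quantity is `ϖ·(σϖ^b)⁻¹·(D₀ + N(x)D₁)∕(D₀D₁)`
  have hid : ϖ * ((!![(D 0)⁻¹, -σ x * (σ ϖ ^ b)⁻¹ * (D 0)⁻¹, (σ x * σ z * (σ ϖ ^ b)⁻¹ - σ y) * (σ ϖ ^ c)⁻¹ * (D 0)⁻¹;
        0, (σ ϖ ^ b)⁻¹ * (D 1)⁻¹, -σ z * (σ ϖ ^ b)⁻¹ * (σ ϖ ^ c)⁻¹ * (D 1)⁻¹;
        0, 0, (σ ϖ ^ c)⁻¹ * (D 2)⁻¹] : Matrix (Fin 3) (Fin 3) K) 1 1) -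
      x * (ϖ * ((!![(D 0)⁻¹, -σ x * (σ ϖ ^ b)⁻¹ * (D 0)⁻¹, (σ x * σ z * (σ ϖ ^ b)⁻¹ - σ y) * (σ ϖ ^ c)⁻¹ * (D 0)⁻¹;
        0, (σ ϖ ^ b)⁻¹ * (D 1)⁻¹, -σ z * (σ ϖ ^ b)⁻¹ * (σ ϖ ^ c)⁻¹ * (D 1)⁻¹;
        0, 0, (σ ϖ ^ c)⁻¹ * (D 2)⁻¹] : Matrix (Fin 3) (Fin 3) K) 0 1)) =
      ϖ * (σ ϖ ^ b)⁻¹ * ((D 0 + x * σ x * D 1) * ((D 0)⁻¹ * (D 1)⁻¹)) := by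
    change ϖ * ((σ ϖ ^ b)⁻¹ * (D 1)⁻¹) - x * (ϖ * (-σ x * (σ ϖ ^ b)⁻¹ * (D 0)⁻¹)) = _
    have h0 := hD0 0
    have h1 := hD0 1
    field_simp
    ring
  rw [hid] at h2
  have hcoef : Valued.v (ϖ * (σ ϖ ^ b)⁻¹) = WithZero.exp (-1 + (b : ℤ)) := by
    rw [map_mul, hϖ, v_inv_map_pow hvσ hϖ, ← WithZero.exp_add]
  have hq : Valued.v (ϖ ^ b) = WithZero.exp (-(b : ℤ)) := by
    rw [map_pow, hϖ, ← WithZero.exp_nsmul]; congr 1; simp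
  rw [map_mul, hcoef, map_mul, map_mul, map_inv₀, map_inv₀, hq] at h2
  have hne : WithZero.exp (-1 + (b : ℤ)) ≠ 0 := WithZero.exp_ne_zero
  calc Valued.v (D 0 + x * σ x * D 1) * ((Valued.v (D 0))⁻¹ * (Valued.v (D 1))⁻¹)
      = (WithZero.exp (-1 + (b : ℤ)))⁻¹ * (WithZero.exp (-1 + (b : ℤ)) * (Valued.v (D 0 + x * σ x * D 1) * ((Valued.v (D 0))⁻¹ * (Valued.v (D 1))⁻¹))) := by
        rw [inv_mul_cancel_left₀ hne]
    _ ≤ (WithZero.exp (-1 + (b : ℤ)))⁻¹ * WithZero.exp (-(b : ℤ)) := mul_le_mul' le_rfl h2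
    _ = WithZero.exp (1 - 2 * (b : ℤ)) := by rw [← WithZero.exp_neg, ← WithZero.exp_add, WithZero.exp_inj]; ring

/-- **COLUMN 2, TEST 3: `|S| ≤ |ϖ|^{2c−1}`** with `S = D₂⁻¹ + N(z)·(N(ϖ^b)D₁)⁻¹ + (xz − yϖ^b)·σ(xz − yϖ^b)·(N(ϖ^b)D₀)⁻¹` (= `1∕D₂ + N(z)∕(N(ϖ^b)D₁) + N(u)∕D₀`, `ϖ^bu = xz − yϖ^b`;
the dual-Gram entry `ϖ·G″₂₂` is integral). [cite: Jacobowitz1962, §4, §7–§8] -/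
theorem v_dualGram22_le {σ : K →+* K} (hvσ : ∀ a, Valued.v (σ a) = Valued.v a) {ϖ : K} (hϖ : Valued.v ϖ = WithZero.exp (-1 : ℤ))
    {D : Fin 3 → K} (hD0 : ∀ i, D i ≠ 0) (b c : ℕ) (x y z : K) {d : ℕ}
    (hM : IsVertexLattice σ ϖ (Matrix.diagonal D) d (latt (Matrix.of ![![1, 0, 0], ![x, ϖ ^ b, 0], ![y, z, ϖ ^ c]]))) :
    Valued.v ((D 2)⁻¹ + z * σ z * (ϖ ^ b * σ ϖ ^ b * D 1)⁻¹ + (x * z - y * ϖ ^ b) * (σ x * σ z - σ y * σ ϖ ^ b) * (ϖ ^ b * σ ϖ ^ b * D 0)⁻¹) ≤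
      WithZero.exp (-(2 * (c : ℤ) - 1)) := by
  have hϖ0 : ϖ ≠ 0 := (Valuation.ne_zero_iff Valued.v).1 (by rw [hϖ]; exact WithZero.exp_ne_zero)
  have hσϖ : σ ϖ ≠ 0 := (map_ne_zero σ).2 hϖ0
  have hmem := smul_dualFrame_col_mem hvσ hϖ0 hD0 b c x y z hM 2
  rw [mem_latt_hnf_iff x y z (pow_ne_zero b hϖ0) (pow_ne_zero c hϖ0)] at hmem
  obtain ⟨-, -, h3⟩ := hmem
  simp only [Pi.smul_apply, smul_eq_mul, Matrix.mulVec_single_one, Matrix.col_apply] at h3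
  have hid : (ϖ * ((!![(D 0)⁻¹, -σ x * (σ ϖ ^ b)⁻¹ * (D 0)⁻¹, (σ x * σ z * (σ ϖ ^ b)⁻¹ - σ y) * (σ ϖ ^ c)⁻¹ * (D 0)⁻¹;
        0, (σ ϖ ^ b)⁻¹ * (D 1)⁻¹, -σ z * (σ ϖ ^ b)⁻¹ * (σ ϖ ^ c)⁻¹ * (D 1)⁻¹;
        0, 0, (σ ϖ ^ c)⁻¹ * (D 2)⁻¹] : Matrix (Fin 3) (Fin 3) K) 2 2) -
        y * (ϖ * ((!![(D 0)⁻¹, -σ x * (σ ϖ ^ b)⁻¹ * (D 0)⁻¹, (σ x * σ z * (σ ϖ ^ b)⁻¹ - σ y) * (σ ϖ ^ c)⁻¹ * (D 0)⁻¹;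
        0, (σ ϖ ^ b)⁻¹ * (D 1)⁻¹, -σ z * (σ ϖ ^ b)⁻¹ * (σ ϖ ^ c)⁻¹ * (D 1)⁻¹;
        0, 0, (σ ϖ ^ c)⁻¹ * (D 2)⁻¹] : Matrix (Fin 3) (Fin 3) K) 0 2))) * ϖ ^ b -
      z * (ϖ * ((!![(D 0)⁻¹, -σ x * (σ ϖ ^ b)⁻¹ * (D 0)⁻¹, (σ x * σ z * (σ ϖ ^ b)⁻¹ - σ y) * (σ ϖ ^ c)⁻¹ * (D 0)⁻¹;
        0, (σ ϖ ^ b)⁻¹ * (D 1)⁻¹, -σ z * (σ ϖ ^ b)⁻¹ * (σ ϖ ^ c)⁻¹ * (D 1)⁻¹;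
        0, 0, (σ ϖ ^ c)⁻¹ * (D 2)⁻¹] : Matrix (Fin 3) (Fin 3) K) 1 2) -
        x * (ϖ * ((!![(D 0)⁻¹, -σ x * (σ ϖ ^ b)⁻¹ * (D 0)⁻¹, (σ x * σ z * (σ ϖ ^ b)⁻¹ - σ y) * (σ ϖ ^ c)⁻¹ * (D 0)⁻¹;
        0, (σ ϖ ^ b)⁻¹ * (D 1)⁻¹, -σ z * (σ ϖ ^ b)⁻¹ * (σ ϖ ^ c)⁻¹ * (D 1)⁻¹;
        0, 0, (σ ϖ ^ c)⁻¹ * (D 2)⁻¹] : Matrix (Fin 3) (Fin 3) K) 0 2))) =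
      ϖ * ϖ ^ b * (σ ϖ ^ c)⁻¹ *
        ((D 2)⁻¹ + z * σ z * (ϖ ^ b * σ ϖ ^ b * D 1)⁻¹ + (x * z - y * ϖ ^ b) * (σ x * σ z - σ y * σ ϖ ^ b) * (ϖ ^ b * σ ϖ ^ b * D 0)⁻¹) := by
    change (ϖ * ((σ ϖ ^ c)⁻¹ * (D 2)⁻¹) - y * (ϖ * ((σ x * σ z * (σ ϖ ^ b)⁻¹ - σ y) * (σ ϖ ^ c)⁻¹ * (D 0)⁻¹))) * ϖ ^ b -
      z * (ϖ * (-σ z * (σ ϖ ^ b)⁻¹ * (σ ϖ ^ c)⁻¹ * (D 1)⁻¹) - x * (ϖ * ((σ x * σ z * (σ ϖ ^ b)⁻¹ - σ y) * (σ ϖ ^ c)⁻¹ * (D 0)⁻¹))) = _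
    have hb : σ ϖ ^ b ≠ 0 := pow_ne_zero _ hσϖ
    have hc : σ ϖ ^ c ≠ 0 := pow_ne_zero _ hσϖ
    field_simp
    ring
  rw [hid] at h3
  have hq : ∀ n : ℕ, Valued.v (ϖ ^ n) = WithZero.exp (-(n : ℤ)) := fun n => by
    rw [map_pow, hϖ, ← WithZero.exp_nsmul]; congr 1; simp
  have hcoef : Valued.v (ϖ * ϖ ^ b * (σ ϖ ^ c)⁻¹) = WithZero.exp (-1 - (b : ℤ) + c) := by
    rw [map_mul, map_mul, hϖ, hq, v_inv_map_pow hvσ hϖ, ← WithZero.exp_add, ← WithZero.exp_add, WithZero.exp_inj]; ring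
  have hpr : Valued.v (ϖ ^ b * ϖ ^ c) = WithZero.exp (-(b : ℤ) - c) := by
    rw [map_mul, hq, hq, ← WithZero.exp_add, WithZero.exp_inj]; ring
  rw [map_mul, hcoef, hpr] at h3
  have hne : WithZero.exp (-1 - (b : ℤ) + c) ≠ 0 := WithZero.exp_ne_zero
  calc Valued.v ((D 2)⁻¹ + z * σ z * (ϖ ^ b * σ ϖ ^ b * D 1)⁻¹ + (x * z - y * ϖ ^ b) * (σ x * σ z - σ y * σ ϖ ^ b) * (ϖ ^ b * σ ϖ ^ b * D 0)⁻¹)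
      = (WithZero.exp (-1 - (b : ℤ) + c))⁻¹ * (WithZero.exp (-1 - (b : ℤ) + c) *
          Valued.v ((D 2)⁻¹ + z * σ z * (ϖ ^ b * σ ϖ ^ b * D 1)⁻¹ + (x * z - y * ϖ ^ b) * (σ x * σ z - σ y * σ ϖ ^ b) * (ϖ ^ b * σ ϖ ^ b * D 0)⁻¹)) := by
        rw [inv_mul_cancel_left₀ hne]
    _ ≤ (WithZero.exp (-1 - (b : ℤ) + c))⁻¹ * WithZero.exp (-(b : ℤ) - c) := mul_le_mul' le_rfl h3
    _ = WithZero.exp (-(2 * (c : ℤ) - 1)) := by rw [← WithZero.exp_neg, ← WithZero.exp_add, WithZero.exp_inj]; ring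

/-! ## §3  HEAD — X1 is not type-2 polarisable -/

/-- **X1 IS NOT TYPE-2 POLARISABLE** (the 11th disjunct of ★ `typeTwo_sieve`).  For `σ` valuation-preserving with even valuations on its fixed points, `|ϖ| = exp(−1)`, `x y z ∈ 𝒪`,
the normalised HNF lattice `N = (1 0 0; x ϖ^b 0; y z ϖ^c)·𝒪³` with `b ≥ 2` even, `c ∈ {1, 2}`, `|z| ≤ |ϖ|^c`, `|y| = 1`, `|xz − yϖ^b| ≤ |ϖ|^c` is a type-2 vertex lattice for NO
`σ`-fixed non-degenerate diagonal form: `c = 2` dies on `G₀₀` (unique dominant term `N(y)D₂` once `|D₀ + N(x)D₁| ≤ exp 1` by column 1 of the dual frame), `c = 1` on the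
dual-Gram entry `G″₂₂` (unique unit term `1∕D₂` once `D₀ + N(x)D₁ ∈ 𝒪` by `G₀₀`). [cite: Jacobowitz1962, §7–§8] [cite: Kottwitz1986BaseChangeUnits, §1 pp. 240–241]
[cite: Serre1980Trees, II §1.1] -/
theorem not_typeTwoPolarisable_X1 {σ : K →+* K} (hvσ : ∀ a, Valued.v (σ a) = Valued.v a)
    (hfix : ∀ t : K, σ t = t → t ≠ 0 → ∃ n : ℤ, Valued.v t = WithZero.exp (2 * n))
    {ϖ : K} (hϖ : Valued.v ϖ = WithZero.exp (-1 : ℤ)) {b c : ℕ} {x y z : K}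
    (hx : Valued.v x ≤ 1) (hy : Valued.v y ≤ 1) (hz : Valued.v z ≤ 1)
    (hn : IsNormalisedLattice (latt (Matrix.of ![![1, 0, 0], ![x, ϖ ^ b, 0], ![y, z, ϖ ^ c]])))
    (hb2 : 2 ≤ b) (hbe : b % 2 = 0) (hc : c = 1 ∨ c = 2) (hzc : Valued.v z ≤ Valued.v (ϖ ^ c)) (hy1 : Valued.v y = 1)
    (hwc : Valued.v (x * z - y * ϖ ^ b) ≤ Valued.v (ϖ ^ c)) :
    ¬ ∃ D : Fin 3 → K, (∀ i, σ (D i) = D i ∧ D i ≠ 0) ∧ IsVertexLattice σ ϖ (Matrix.diagonal D) 2 (latt (Matrix.of ![![1, 0, 0], ![x, ϖ ^ b, 0], ![y, z, ϖ ^ c]])) := by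
  rintro ⟨D, hDfix, hM⟩
  have hD0 : ∀ i, D i ≠ 0 := fun i => (hDfix i).2
  have hϖ0 : ϖ ≠ 0 := (Valuation.ne_zero_iff Valued.v).1 (by rw [hϖ]; exact WithZero.exp_ne_zero)
  have hq : ∀ n : ℕ, Valued.v (ϖ ^ n) = WithZero.exp (-(n : ℤ)) := fun n => by
    rw [map_pow, hϖ, ← WithZero.exp_nsmul]
    congr 1
    simp
  have hq1 : ∀ n : ℕ, Valued.v (ϖ ^ n) ≤ 1 := fun n => by
    rw [hq, ← WithZero.exp_zero, WithZero.exp_le_exp]; omega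
  have hσϖb : Valued.v (σ ϖ ^ b) = WithZero.exp (-(b : ℤ)) := by rw [map_pow, hvσ, ← map_pow, hq]
  -- `|x| = 1` (row-2 normalisation, `b ≥ 1`)
  have hN := (normalised_latt_hnf_iff hx hy hz (hq1 b) (hq1 c)).1 hn
  have hx1 : Valued.v x = 1 := hN.1.resolve_left fun h => by
    rw [hq, ← WithZero.exp_zero, WithZero.exp_inj] at h; omega
  -- evenness, sandwich, Gram values
  obtain ⟨e₀, he₀⟩ := hfix (D 0) (hDfix 0).1 (hD0 0)
  obtain ⟨e₁, he₁⟩ := hfix (D 1) (hDfix 1).1 (hD0 1)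
  obtain ⟨e₂, he₂⟩ := hfix (D 2) (hDfix 2).1 (hD0 2)
  obtain ⟨⟨hA2l, hA2u⟩, ⟨hA1b, -, hA1eq⟩, ⟨-, hA0x, -, hA0eq⟩⟩ := dualFrame_sandwich hvσ hϖ hD0 b c hn hM
  obtain ⟨-, -, hG00, -⟩ := gram_values_of_type hvσ hϖ0 D b c x y z hM
  -- `|z|·exp(b+c) ≤ exp b` and `|xz − yϖ^b|·exp(b+c) ≤ exp b`
  have hzb : Valued.v z * WithZero.exp ((b : ℤ) + c) ≤ WithZero.exp (b : ℤ) := by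
    calc Valued.v z * WithZero.exp ((b : ℤ) + c) ≤ Valued.v (ϖ ^ c) * WithZero.exp ((b : ℤ) + c) := mul_le_mul' hzc le_rfl
      _ = WithZero.exp (b : ℤ) := by rw [hq, ← WithZero.exp_add]; congr 1; ring
  have hwb : Valued.v (x * z - y * ϖ ^ b) * WithZero.exp ((b : ℤ) + c) ≤ WithZero.exp (b : ℤ) := by
    calc Valued.v (x * z - y * ϖ ^ b) * WithZero.exp ((b : ℤ) + c) ≤ Valued.v (ϖ ^ c) * WithZero.exp ((b : ℤ) + c) := mul_le_mul' hwc le_rfl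
      _ = WithZero.exp (b : ℤ) := by rw [hq, ← WithZero.exp_add]; congr 1; ring
  -- `|D₁| = |D₀| = exp b`, `|D₂| = exp 2(c−1)`
  have h2e1 : 2 * e₁ = (b : ℤ) := by
    have hl : (b : ℤ) - 1 ≤ 2 * e₁ := by rw [he₁, hϖ, ← WithZero.exp_add, WithZero.exp_le_exp] at hA1b; omega
    have hu : 2 * e₁ ≤ (b : ℤ) := by
      rcases hA1eq with h | h
      · rw [he₁, WithZero.exp_le_exp] at h; exact h
      · have := h.trans hzb; rw [he₁, WithZero.exp_le_exp] at this; exact this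
    omega
  have h2e0 : 2 * e₀ = (b : ℤ) := by
    have hl : (b : ℤ) - 1 ≤ 2 * e₀ := by rw [he₀, hϖ, hx1, one_mul, ← WithZero.exp_add, WithZero.exp_le_exp] at hA0x; omega
    have hu : 2 * e₀ ≤ (b : ℤ) := by
      rcases hA0eq with h | h | h
      · rw [he₀, ← WithZero.exp_zero, WithZero.exp_le_exp] at h; omega
      · rw [he₀, hx1, one_mul, WithZero.exp_le_exp] at h; exact h
      · have := h.trans hwb; rw [he₀, WithZero.exp_le_exp] at this; exact this
    omega
  have h2e2 : 2 * e₂ = 2 * ((c : ℤ) - 1) := by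
    have hl : (c : ℤ) - 1 ≤ 2 * e₂ := by rw [he₂, hϖ, ← WithZero.exp_add, WithZero.exp_le_exp] at hA2l; omega
    have hu : 2 * e₂ ≤ (c : ℤ) := by rw [he₂, WithZero.exp_le_exp] at hA2u; exact hA2u
    rcases hc with rfl | rfl <;> push_cast at hl hu ⊢ <;> omega
  have hvD0 : Valued.v (D 0) = WithZero.exp (b : ℤ) := by rw [he₀, h2e0]
  have hvD1 : Valued.v (D 1) = WithZero.exp (b : ℤ) := by rw [he₁, h2e1]
  have hvD2 : Valued.v (D 2) = WithZero.exp (2 * ((c : ℤ) - 1)) := by rw [he₂, h2e2]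
  -- the norm term `N(y)D₂`
  have hvNy : Valued.v (σ y * D 2 * y) = WithZero.exp (2 * ((c : ℤ) - 1)) := by rw [map_mul, map_mul, hvσ, hy1, hvD2, one_mul, mul_one]
  rcases hc with rfl | rfl
  · -- ### `c = 1`: `E := D₀ + N(x)D₁ ∈ 𝒪` from `G₀₀`, then `|S| = 1 > |ϖ|` contradicts column 2
    have hE : Valued.v (D 0 + x * σ x * D 1) ≤ 1 := by
      have h : D 0 + x * σ x * D 1 = (D 0 + σ x * D 1 * x + σ y * D 2 * y) - σ y * D 2 * y := by ring
      rw [h]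
      refine Valuation.map_sub_le _ hG00 ?_
      rw [hvNy]; push_cast; simp
    have hS := v_dualGram22_le hvσ hϖ hD0 b 1 x y z hM
    -- `S − D₂⁻¹ = [N(z)E + D₁(N(y)ϖ^bσϖ^b − xzσyσϖ^b − yϖ^bσxσz)] ∕ (ϖ^bσϖ^b D₀ D₁)`
    have hid : (D 2)⁻¹ + z * σ z * (ϖ ^ b * σ ϖ ^ b * D 1)⁻¹ + (x * z - y * ϖ ^ b) * (σ x * σ z - σ y * σ ϖ ^ b) * (ϖ ^ b * σ ϖ ^ b * D 0)⁻¹ =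
        (D 2)⁻¹ + (z * σ z * (D 0 + x * σ x * D 1) + D 1 * (y * σ y * (ϖ ^ b * σ ϖ ^ b) - x * z * σ y * σ ϖ ^ b - y * ϖ ^ b * (σ x * σ z))) *
          (ϖ ^ b * σ ϖ ^ b * D 0 * D 1)⁻¹ := by
      have h0 := hD0 0; have h1 := hD0 1
      have hp : ϖ ^ b ≠ 0 := pow_ne_zero _ hϖ0
      have hsp : σ ϖ ^ b ≠ 0 := pow_ne_zero _ ((map_ne_zero σ).2 hϖ0)
      field_simp
      ring
    rw [hid] at hS
    -- the correction term is small: `≤ exp(−1)`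
    have hsmall : Valued.v ((z * σ z * (D 0 + x * σ x * D 1) + D 1 * (y * σ y * (ϖ ^ b * σ ϖ ^ b) - x * z * σ y * σ ϖ ^ b - y * ϖ ^ b * (σ x * σ z))) *
        (ϖ ^ b * σ ϖ ^ b * D 0 * D 1)⁻¹) ≤ WithZero.exp (-1 : ℤ) := by
      have hz1 : Valued.v z ≤ WithZero.exp (-1 : ℤ) := by rw [pow_one] at hzc; rwa [hϖ] at hzc
      have hden : Valued.v ((ϖ ^ b * σ ϖ ^ b * D 0 * D 1)⁻¹) = 1 := by
        rw [map_inv₀, map_mul, map_mul, map_mul, hq, hσϖb, hvD0, hvD1, ← WithZero.exp_add, ← WithZero.exp_add, ← WithZero.exp_add]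
        rw [show -(b : ℤ) + -(b : ℤ) + b + b = 0 by ring, WithZero.exp_zero, inv_one]
      rw [map_mul, hden, mul_one]
      refine Valuation.map_add_le _ ?_ ?_
      · -- `|N(z)E| ≤ |z| ≤ exp(−1)`
        rw [map_mul, map_mul, hvσ]
        calc Valued.v z * Valued.v z * Valued.v (D 0 + x * σ x * D 1) ≤ WithZero.exp (-1 : ℤ) * 1 * 1 :=
              mul_le_mul' (mul_le_mul' hz1 hz) hE
          _ = WithZero.exp (-1 : ℤ) := by rw [mul_one, mul_one]
      · rw [map_mul, hvD1]
        -- `exp b · |N(y)N(ϖ^b) − xzσyσϖ^b − yϖ^bσxσz| ≤ exp b · max(exp(−2b), |z|exp(−b), |z| exp(−b))`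
        have h1 : Valued.v (y * σ y * (ϖ ^ b * σ ϖ ^ b)) ≤ WithZero.exp (-(b : ℤ) - 1) := by
          rw [map_mul, map_mul, map_mul, hvσ, hy1, hq, hσϖb, one_mul, one_mul, ← WithZero.exp_add, WithZero.exp_le_exp]; omega
        have h2 : Valued.v (x * z * σ y * σ ϖ ^ b) ≤ WithZero.exp (-(b : ℤ) - 1) := by
          rw [map_mul, map_mul, map_mul, hx1, hvσ, hy1, hσϖb, one_mul, mul_one]
          calc Valued.v z * WithZero.exp (-(b : ℤ)) ≤ WithZero.exp (-1 : ℤ) * WithZero.exp (-(b : ℤ)) := mul_le_mul' hz1 le_rfl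
            _ = WithZero.exp (-(b : ℤ) - 1) := by rw [← WithZero.exp_add]; congr 1; ring
        have h3 : Valued.v (y * ϖ ^ b * (σ x * σ z)) ≤ WithZero.exp (-(b : ℤ) - 1) := by
          rw [map_mul, map_mul, map_mul, hy1, hq, hvσ, hvσ, hx1, one_mul, one_mul]
          calc WithZero.exp (-(b : ℤ)) * Valued.v z ≤ WithZero.exp (-(b : ℤ)) * WithZero.exp (-1 : ℤ) := mul_le_mul' le_rfl hz1
            _ = WithZero.exp (-(b : ℤ) - 1) := by rw [← WithZero.exp_add]; congr 1
        calc WithZero.exp (b : ℤ) * Valued.v (y * σ y * (ϖ ^ b * σ ϖ ^ b) - x * z * σ y * σ ϖ ^ b - y * ϖ ^ b * (σ x * σ z))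
            ≤ WithZero.exp (b : ℤ) * WithZero.exp (-(b : ℤ) - 1) :=
              mul_le_mul' le_rfl (Valuation.map_sub_le _ (Valuation.map_sub_le _ h1 h2) h3)
          _ = WithZero.exp (-1 : ℤ) := by rw [← WithZero.exp_add]; congr 1; ring
    -- hence `|S| = |D₂⁻¹| = 1`
    have hD2unit : Valued.v ((D 2)⁻¹) = 1 := by rw [map_inv₀, hvD2]; push_cast; simp
    have hSeq : Valued.v ((D 2)⁻¹ + (z * σ z * (D 0 + x * σ x * D 1) + D 1 * (y * σ y * (ϖ ^ b * σ ϖ ^ b) - x * z * σ y * σ ϖ ^ b - y * ϖ ^ b * (σ x * σ z))) *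
          (ϖ ^ b * σ ϖ ^ b * D 0 * D 1)⁻¹) = 1 := by
      rw [Valuation.map_add_eq_of_lt_left _ ?_]
      · exact hD2unit
      · rw [hD2unit]
        exact lt_of_le_of_lt hsmall (by rw [← WithZero.exp_zero, WithZero.exp_lt_exp]; omega)
    rw [hSeq] at hS
    rw [← WithZero.exp_zero, WithZero.exp_le_exp] at hS
    omega
  · -- ### `c = 2`: column 1 gives `|D₀ + N(x)D₁| ≤ exp 1 < exp 2 = |N(y)D₂|`, so `|G₀₀| = exp 2 > 1`
    have hE := v_gramCore_le hvσ hϖ hD0 b 2 x y z hM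
    rw [hvD0, hvD1, ← WithZero.exp_neg, ← WithZero.exp_add] at hE
    have hE' : Valued.v (D 0 + x * σ x * D 1) ≤ WithZero.exp (1 : ℤ) := by
      have hne : WithZero.exp (-(b : ℤ) + -(b : ℤ)) ≠ 0 := WithZero.exp_ne_zero
      calc Valued.v (D 0 + x * σ x * D 1)
          = Valued.v (D 0 + x * σ x * D 1) * WithZero.exp (-(b : ℤ) + -(b : ℤ)) * (WithZero.exp (-(b : ℤ) + -(b : ℤ)))⁻¹ := by
            rw [mul_inv_cancel_right₀ hne]
        _ ≤ WithZero.exp (1 - 2 * (b : ℤ)) * (WithZero.exp (-(b : ℤ) + -(b : ℤ)))⁻¹ := mul_le_mul' hE le_rfl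
        _ = WithZero.exp (1 : ℤ) := by rw [← WithZero.exp_neg, ← WithZero.exp_add, WithZero.exp_inj]; ring
    have hlt : Valued.v (D 0 + σ x * D 1 * x) < Valued.v (σ y * D 2 * y) := by
      rw [show D 0 + σ x * D 1 * x = D 0 + x * σ x * D 1 by ring, hvNy]
      exact lt_of_le_of_lt hE' (by push_cast; rw [WithZero.exp_lt_exp]; omega)
    have hsum : D 0 + σ x * D 1 * x + σ y * D 2 * y = σ y * D 2 * y + (D 0 + σ x * D 1 * x) := by ring
    have h := hG00
    rw [hsum, Valuation.map_add_eq_of_lt_left _ hlt, hvNy, ← WithZero.exp_zero, WithZero.exp_le_exp] at h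
    omega

end Summit.HodgeConjecture.HodgeConjecture.Cruxes.H413.F0P3cDyRamDiagonalTypeTwoExclX1

end
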